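import Literature.Barriers.RiemannHypothesis.DavenportHeilbronnHamburgerIntegrand
import Literature.Barriers.RiemannHypothesis.DavenportHeilbronnHamburgerDecay
import HarnessLib

/-!
# Tools for Hamburger's theorem, VI: the contour shift for `∑ aₙ/(t² + n²)`

Support file for the discharge of `Literature.Barriers.RiemannHypothesis.Hamburger`
(Titchmarsh, *The Theory of the Riemann Zeta-Function*, §2.13). Everything here is PROVED.

With `F_t(w) = f(2w)Γ(w)Γ(1−w)t^{2w−2}` (`DavenportHeilbronnHamburgerIntegrand`) and the
parameters `c, c', T` of `Hamburger1921.exists_shift_parameters` we prove, for `t > 0`: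

* `F_t` is absolutely integrable along `re w = c` and `re w = c'`, and tends to `0` uniformly on
  the horizontal segments `c' ≤ re w ≤ c`, `|im w| → ∞` (Phragmén–Lindelöf decay of
  `f(2w)Γ(w)π^{−w}`, `DavenportHeilbronnHamburgerDecay`);
* hence (`Hamburger1921.integral_vertical_sub_eq_rectBoundaryIntegral`) the line `re w = c` may be
  moved to `re w = c'` at the cost of the boundary integral over the box `[c', c] × [−T, T]`
  (`integral_right_line_eq_left_sub_box`);
* the integral over the left line is `(2π²/t) ∑ bₙ e^{−2πnt}` (`integral_left_line_eq`: the
  functional equation and duplication formula of `integrand_left_line`, the substitution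
  `y ↦ −2y`, and the Cahen–Mellin integral).

## References

* [Titchmarsh1986] E. C. Titchmarsh, *The Theory of the Riemann Zeta-Function*, 2nd ed. revised by
  D. R. Heath-Brown, Oxford 1986, §2.13.
-/

noncomputable section

open _root_.Complex Set MeasureTheory Filter Real
open scoped _root_.Topology

namespace Literature.Barriers.RiemannHypothesis

namespace Hamburger1921

open Literature.Analysis.Complex Literature.Analysis.SpecialFunctions

section shift

variable {a b : ℕ → ℂ} {G : ℂ → ℂ} {P : Polynomial ℂ} {α c c' T : ℝ}

/-! ### Integrability along the two lines -/

/-- **Integrability on the right line.** For `t > 0`, `y ↦ F_t(c + iy) = L(a, 2w)Γ(w)Γ(1−w)t^{2w−2}`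
is integrable (`|L(a, 2w)| ≤ ∑ |aₙ| n^{−2c}`, `Γ(w)Γ(1−w)` integrable). [folklore] -/
theorem integrable_integrand_right_line (hG : Differentiable ℂ G) (hc : 1 / 2 < c) (hc1 : c < 1)
    (ha : ∀ s : ℂ, 1 < s.re → LSeriesSummable a s ∧ P.eval s * LSeries a s = G s)
    (hroots : ∀ ρ : ℂ, P.eval ρ = 0 → ρ.re / 2 ≠ c ∧ ρ.re / 2 ≠ c' ∧ |ρ.im| / 2 < T)
    {t : ℝ} (ht : 0 < t) {F : ℂ → ℂ}
    (hF : ∀ w, F w = G (2 * w) / P.eval (2 * w) * (Complex.Gamma w * Complex.Gamma (1 - w)) *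
      (t : ℂ) ^ (2 * w - 2)) :
    Integrable fun y : ℝ ↦ F (c + y * I) := by
  have hΓΓ := integrable_Gamma_mul_Gamma_one_sub (by linarith : (0 : ℝ) < c) hc1
  have hLa : LSeriesSummable a ((2 * c : ℝ) : ℂ) := by
    have h := (ha (2 * c) (by simp; linarith)).1
    convert h using 1; push_cast; ring
  have hPne : ∀ y : ℝ, P.eval (2 * ((c : ℂ) + y * I)) ≠ 0 :=
    fun y ↦ (integrand_right_line hc ha hroots hF y).1
  have hcont : Continuous fun y : ℝ ↦ G (2 * ((c : ℂ) + y * I)) / P.eval (2 * ((c : ℂ) + y * I)) *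
      (t : ℂ) ^ (2 * ((c : ℂ) + y * I) - 2) := by
    refine Continuous.mul (Continuous.div ?_ ?_ hPne) ?_
    · exact hG.continuous.comp (by fun_prop)
    · exact P.continuous.comp (by fun_prop)
    · exact Continuous.const_cpow (by fun_prop) (Or.inl (ofReal_ne_zero.2 ht.ne'))
  have h := hΓΓ.bdd_mul hcont.aestronglyMeasurable
    (c := (∑' n, ‖LSeries.term a ((2 * c : ℝ) : ℂ) n‖) * t ^ (2 * c - 2))
    (Eventually.of_forall fun y ↦ ?_)
  · refine h.congr (Eventually.of_forall fun y ↦ ?_)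
    simp only [hF]; ring
  · have hPw := hPne y
    have h2re : (2 * ((c : ℂ) + y * I)).re = (2 * c : ℝ) := by simp
    obtain ⟨-, hGeq⟩ := ha (2 * ((c : ℂ) + y * I)) (by rw [h2re]; linarith)
    have hGP : G (2 * ((c : ℂ) + y * I)) / P.eval (2 * ((c : ℂ) + y * I)) =
        LSeries a (2 * ((c : ℂ) + y * I)) := by
      rw [← hGeq, mul_div_cancel_left₀ _ hPw]
    have hre : (2 * ((c : ℂ) + y * I) - 2).re = 2 * c - 2 := by simp
    rw [norm_mul, hGP, Complex.norm_cpow_eq_rpow_re_of_pos ht, hre]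
    exact mul_le_mul_of_nonneg_right (norm_LSeries_le_tsum h2re hLa) (by positivity)

/-- `y ↦ L(b, C + iy)` is continuous on a line of absolute convergence. [folklore] -/
theorem continuous_LSeries_line {b : ℕ → ℂ} {C : ℝ} (hbC : LSeriesSummable b C) :
    Continuous fun y : ℝ ↦ LSeries b ((C : ℂ) + y * I) := by
  simp only [LSeries]
  refine continuous_tsum (fun n ↦ ?_) hbC.norm (fun n y ↦ le_of_eq ?_)
  · rcases eq_or_ne n 0 with rfl | hn
    · simp only [LSeries.term_zero]; exact continuous_const
    · simp only [LSeries.term_of_ne_zero hn, div_eq_mul_inv]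
      refine continuous_const.mul (Continuous.inv₀ ?_ fun y ↦ ?_)
      · exact Continuous.const_cpow (by fun_prop) (Or.inl (by exact_mod_cast hn))
      · exact Complex.cpow_ne_zero_iff.2 (Or.inl (by exact_mod_cast hn))
  · simp [LSeries.norm_term_eq]

/-- The Cahen–Mellin integrand `y ↦ L(b, C+iy) W^{−(C+iy)} Γ(C+iy)` is integrable on a line of
absolute convergence `C > 0` (`W > 0`). [folklore] -/
theorem integrable_cahenMellin_integrand {b : ℕ → ℂ} {C W : ℝ} (hC : 0 < C)
    (hbC : LSeriesSummable b C) (hW : 0 < W) :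
    Integrable fun y : ℝ ↦ LSeries b ((C : ℂ) + y * I) *
      (((W : ℝ) : ℂ) ^ (-((C : ℂ) + y * I)) * Complex.Gamma ((C : ℂ) + y * I)) := by
  have hΓ := integrable_Gamma_vertical_of_pos hC
  have hcont : Continuous fun y : ℝ ↦ LSeries b ((C : ℂ) + y * I) *
      ((W : ℝ) : ℂ) ^ (-((C : ℂ) + y * I)) :=
    (continuous_LSeries_line hbC).mul
      (Continuous.const_cpow (by fun_prop) (Or.inl (ofReal_ne_zero.2 hW.ne')))
  have h := hΓ.bdd_mul hcont.aestronglyMeasurable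
    (c := (∑' n, ‖LSeries.term b (C : ℂ) n‖) * W ^ (-C)) (Eventually.of_forall fun y ↦ ?_)
  · refine h.congr (Eventually.of_forall fun y ↦ ?_)
    ring
  · have hre : (-((C : ℂ) + y * I)).re = -C := by simp
    rw [norm_mul, Complex.norm_cpow_eq_rpow_re_of_pos hW, hre]
    exact mul_le_mul_of_nonneg_right (norm_LSeries_le_tsum (by simp) hbC) (by positivity)

/-- **Integrability on the left line.** For `t > 0`, `y ↦ F_t(c' + iy)` is integrable: by
`integrand_left_line` it is `(2π/t) g(−2y)` with `g` the Cahen–Mellin integrand of `∑ bₙe^{−2πnt}`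
on the line `re v = 1 − 2c'`. [folklore] -/
theorem integrable_integrand_left_line (hc'α : 2 * c' < -α) (hc'h : c' ≤ -1 / 2)
    (hc'N : ∀ n : ℕ, c' ≠ -n)
    (hroots : ∀ ρ : ℂ, P.eval ρ = 0 → ρ.re / 2 ≠ c ∧ ρ.re / 2 ≠ c' ∧ |ρ.im| / 2 < T)
    (hb : ∀ s : ℂ, s.re < -α → LSeriesSummable b (1 - s))
    (hfe : ∀ s : ℂ, s.re < -α → P.eval s ≠ 0 → (∀ n : ℕ, s ≠ -(2 * (n : ℂ))) →
      G s / P.eval s * Complex.Gamma (s / 2) * (π : ℂ) ^ (-s / 2) =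
        LSeries b (1 - s) * Complex.Gamma (1 / 2 - s / 2) * (π : ℂ) ^ (-(1 - s) / 2))
    {t : ℝ} (ht : 0 < t) {F : ℂ → ℂ}
    (hF : ∀ w, F w = G (2 * w) / P.eval (2 * w) * (Complex.Gamma w * Complex.Gamma (1 - w)) *
      (t : ℂ) ^ (2 * w - 2)) :
    Integrable fun y : ℝ ↦ F (c' + y * I) := by
  have hC0 : 0 < 1 - 2 * c' := by linarith
  have hbC : LSeriesSummable b ((1 - 2 * c' : ℝ) : ℂ) := by
    have h := hb (2 * c') (by simp; linarith)
    convert h using 1; push_cast; ring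
  have hW : 0 < 2 * π * t := by positivity
  have hgi := integrable_cahenMellin_integrand hC0 hbC hW
  have heq : (fun y : ℝ ↦ F (c' + y * I)) = fun y ↦ (2 * π / t : ℂ) *
      (fun y' : ℝ ↦ LSeries b (((1 - 2 * c' : ℝ) : ℂ) + y' * I) *
        ((((2 * π * t : ℝ)) : ℂ) ^ (-(((1 - 2 * c' : ℝ) : ℂ) + y' * I)) *
          Complex.Gamma (((1 - 2 * c' : ℝ) : ℂ) + y' * I))) ((-2) * y) :=
    funext fun y ↦ integrand_left_line hc'α hc'N hroots hfe ht hF y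
  rw [heq]
  exact (hgi.comp_mul_left' (by norm_num : (-2 : ℝ) ≠ 0)).const_mul _

/-! ### Decay on the horizontal segments -/

/-- **Uniform decay of `F_t` across the strip.** For `t > 0`, `‖F_t(x + iT')‖ → 0` as `|T'| → ∞`
uniformly in `c' ≤ x ≤ c`: `F_t = [f(2w)Γ(w)π^{−w}] · π^{w}Γ(1−w)t^{2w−2}`, where the first factor
is `O(e^{−|im w|})` (Phragmén–Lindelöf, `exists_norm_le_exp_neg_abs_im`) and the second is bounded.
[cite: Titchmarsh1986, §2.13] -/
theorem integrand_decay (hG : Differentiable ℂ G)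
    (hfin : ∃ A B : ℝ, ∀ s : ℂ, ‖G s‖ ≤ A * Real.exp (‖s‖ ^ B)) (hP : P ≠ 0)
    (ha : ∀ s : ℂ, 1 < s.re → LSeriesSummable a s ∧ P.eval s * LSeries a s = G s)
    (hb : ∀ s : ℂ, s.re < -α → LSeriesSummable b (1 - s))
    (hfe : ∀ s : ℂ, s.re < -α → P.eval s ≠ 0 → (∀ n : ℕ, s ≠ -(2 * (n : ℂ))) →
      G s / P.eval s * Complex.Gamma (s / 2) * (π : ℂ) ^ (-s / 2) =
        LSeries b (1 - s) * Complex.Gamma (1 / 2 - s / 2) * (π : ℂ) ^ (-(1 - s) / 2))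
    (hc : 1 / 2 < c) (hc1 : c < 1) (hc'α : 2 * c' < -α) (hc'h : c' ≤ -1 / 2)
    (hc'N : ∀ n : ℕ, c' ≠ -n)
    (hroots : ∀ ρ : ℂ, P.eval ρ = 0 → ρ.re / 2 ≠ c ∧ ρ.re / 2 ≠ c' ∧ |ρ.im| / 2 < T)
    {t : ℝ} (ht : 0 < t) {F : ℂ → ℂ}
    (hF : ∀ w, F w = G (2 * w) / P.eval (2 * w) * (Complex.Gamma w * Complex.Gamma (1 - w)) *
      (t : ℂ) ^ (2 * w - 2)) :
    ∀ ε : ℝ, 0 < ε → ∃ T₀ : ℝ, ∀ T' : ℝ, T₀ ≤ |T'| → ∀ x ∈ Icc c' c,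
      ‖F (x + T' * I)‖ ≤ ε := by
  have hPc' : ∀ y : ℝ, P.eval (2 * ((c' : ℂ) + y * I)) ≠ 0 := fun y h0 ↦ by
    have := (hroots _ h0).2.1; simp at this
  obtain ⟨K, T₁, hK, hdec⟩ :=
    exists_norm_le_exp_neg_abs_im hG hfin hP ha hb hfe hc hc1.le hc'α hc'h hc'N hPc'
  -- a bound `M` for `Γ(1 − x)`, `x ∈ [c', c]`
  obtain ⟨M, hM⟩ : ∃ M : ℝ, ∀ x ∈ Icc (1 - c) (1 - c'), Real.Gamma x ≤ M := by
    have hcont : ContinuousOn Real.Gamma (Icc (1 - c) (1 - c')) := by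
      refine fun x hx ↦ (Real.differentiableAt_Gamma fun m hm ↦ ?_).continuousAt.continuousWithinAt
      have h0 : (0 : ℝ) ≤ m := Nat.cast_nonneg m
      have h1 := hx.1
      rw [hm] at h1
      linarith
    obtain ⟨M, hM⟩ := isCompact_Icc.exists_bound_of_continuousOn hcont
    exact ⟨M, fun x hx ↦ (Real.le_norm_self _).trans (hM x hx)⟩
  have hM0 : 0 ≤ M :=
    (Real.Gamma_pos_of_pos (by linarith : (0 : ℝ) < 1 - c)).le.trans (hM (1 - c) ⟨le_rfl, by linarith⟩)
  set Ct : ℝ := t ^ (2 * c - 2) + t ^ (2 * c' - 2) with hCt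
  have hCt0 : 0 < Ct := by positivity
  set K' : ℝ := K * π * M * Ct with hK'
  have hK'0 : 0 ≤ K' := by positivity
  have hπ0 : (π : ℂ) ≠ 0 := ofReal_ne_zero.2 Real.pi_ne_zero
  intro ε hε
  refine ⟨max (max T₁ 1) (Real.log (K' / ε)), fun T' hT' x hx ↦ ?_⟩
  have hT₁ : T₁ ≤ |T'| := ((le_max_left _ _).trans (le_max_left _ _)).trans hT'
  set z : ℂ := (x : ℂ) + T' * I with hz
  have hzre : z.re = x := by simp [hz]
  have hzim : z.im = T' := by simp [hz]
  have hπz : (π : ℂ) ^ (-z) ≠ 0 := by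
    rw [Complex.cpow_def_of_ne_zero hπ0]; exact Complex.exp_ne_zero _
  have hFz : F z = (G (2 * z) / P.eval (2 * z) * Complex.Gamma z * (π : ℂ) ^ (-z)) *
      (((π : ℂ) ^ (-z))⁻¹ * Complex.Gamma (1 - z) * (t : ℂ) ^ (2 * z - 2)) := by
    rw [hF z, show (G (2 * z) / P.eval (2 * z) * Complex.Gamma z * (π : ℂ) ^ (-z)) *
      (((π : ℂ) ^ (-z))⁻¹ * Complex.Gamma (1 - z) * (t : ℂ) ^ (2 * z - 2)) =
      G (2 * z) / P.eval (2 * z) * (Complex.Gamma z * Complex.Gamma (1 - z)) * (t : ℂ) ^ (2 * z - 2) *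
        ((π : ℂ) ^ (-z) * ((π : ℂ) ^ (-z))⁻¹) by ring, mul_inv_cancel₀ hπz, mul_one]
  -- the bounded factor
  have h1 : ‖((π : ℂ) ^ (-z))⁻¹‖ ≤ π := by
    rw [norm_inv, Complex.norm_cpow_eq_rpow_re_of_pos Real.pi_pos, neg_re, hzre,
      Real.rpow_neg Real.pi_pos.le, inv_inv]
    calc π ^ x ≤ π ^ (1 : ℝ) :=
          Real.rpow_le_rpow_of_exponent_le (by linarith [Real.pi_gt_three]) (by linarith [hx.2])
      _ = π := Real.rpow_one π
  have h2 : ‖Complex.Gamma (1 - z)‖ ≤ M := by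
    have e : (1 : ℂ) - z = ((1 - x : ℝ) : ℂ) + ((-T' : ℝ) : ℂ) * I := by
      rw [hz]; push_cast; ring
    rw [e]
    exact (GammaVert.norm_Gamma_le_Gamma_re (by linarith [hx.2]) _).trans
      (hM _ ⟨by linarith [hx.2], by linarith [hx.1]⟩)
  have h3 : ‖(t : ℂ) ^ (2 * z - 2)‖ ≤ Ct := by
    rw [Complex.norm_cpow_eq_rpow_re_of_pos ht]
    have hre : (2 * z - 2).re = 2 * x - 2 := by simp [hzre]
    rw [hre, hCt]
    have hp1 : 0 ≤ t ^ (2 * c - 2) := Real.rpow_nonneg ht.le _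
    have hp2 : 0 ≤ t ^ (2 * c' - 2) := Real.rpow_nonneg ht.le _
    rcases le_or_gt 1 t with h1t | h1t
    · have : t ^ (2 * x - 2) ≤ t ^ (2 * c - 2) :=
        Real.rpow_le_rpow_of_exponent_le h1t (by linarith [hx.2])
      linarith
    · have : t ^ (2 * x - 2) ≤ t ^ (2 * c' - 2) :=
        Real.rpow_le_rpow_of_exponent_ge ht h1t.le (by linarith [hx.1])
      linarith
  -- the decaying factor
  have h0 : ‖G (2 * z) / P.eval (2 * z) * Complex.Gamma z * (π : ℂ) ^ (-z)‖ ≤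
      K * Real.exp (-|T'|) := by
    have := hdec z (by rw [hzre]; exact hx.1) (by rw [hzre]; exact hx.2) (by rw [hzim]; exact hT₁)
    rwa [hzim] at this
  -- `K' e^{-|T'|} ≤ ε`
  have hexp : K' * Real.exp (-|T'|) ≤ ε := by
    rcases eq_or_lt_of_le hK'0 with hK'z | hK'pos
    · rw [← hK'z, zero_mul]; exact hε.le
    · have hlog : Real.log (K' / ε) ≤ |T'| := (le_max_right _ _).trans hT'
      have hle : Real.exp (-|T'|) ≤ ε / K' := by
        rw [← Real.le_log_iff_exp_le (div_pos hε hK'pos), Real.log_div hε.ne' hK'pos.ne']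
        rw [Real.log_div hK'pos.ne' hε.ne'] at hlog
        linarith
      calc K' * Real.exp (-|T'|) ≤ K' * (ε / K') := by gcongr
        _ = ε := by field_simp
  calc ‖F z‖ = ‖G (2 * z) / P.eval (2 * z) * Complex.Gamma z * (π : ℂ) ^ (-z)‖ *
        (‖((π : ℂ) ^ (-z))⁻¹‖ * ‖Complex.Gamma (1 - z)‖ * ‖(t : ℂ) ^ (2 * z - 2)‖) := by
        rw [hFz]; simp only [norm_mul]
    _ ≤ (K * Real.exp (-|T'|)) * (π * M * Ct) := by
        refine mul_le_mul h0 ?_ (by positivity) (by positivity)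
        exact mul_le_mul (mul_le_mul h1 h2 (norm_nonneg _) Real.pi_pos.le) h3 (norm_nonneg _)
          (by positivity)
    _ = K' * Real.exp (-|T'|) := by rw [hK']; ring
    _ ≤ ε := hexp

/-! ### The shift and the value of the left integral -/

/-- **Moving the line of integration.** For `t > 0`,
`∫ F_t(c + iy) dy = ∫ F_t(c' + iy) dy − i ∮_{∂([c',c]×[−T,T])} F_t`
(Cauchy's theorem across the strip with the box of singularities kept,
`integral_vertical_sub_eq_rectBoundaryIntegral`). [cite: Titchmarsh1986, §2.13] -/
theorem integral_right_line_eq_left_sub_box (hG : Differentiable ℂ G)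
    (hfin : ∃ A B : ℝ, ∀ s : ℂ, ‖G s‖ ≤ A * Real.exp (‖s‖ ^ B)) (hP : P ≠ 0)
    (ha : ∀ s : ℂ, 1 < s.re → LSeriesSummable a s ∧ P.eval s * LSeries a s = G s)
    (hb : ∀ s : ℂ, s.re < -α → LSeriesSummable b (1 - s))
    (hfe : ∀ s : ℂ, s.re < -α → P.eval s ≠ 0 → (∀ n : ℕ, s ≠ -(2 * (n : ℂ))) →
      G s / P.eval s * Complex.Gamma (s / 2) * (π : ℂ) ^ (-s / 2) =
        LSeries b (1 - s) * Complex.Gamma (1 / 2 - s / 2) * (π : ℂ) ^ (-(1 - s) / 2))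
    (hc : 1 / 2 < c) (hc1 : c < 1) (hc'α : 2 * c' < -α) (hc'h : c' ≤ -1 / 2) (hT : 0 < T)
    (hc'N : ∀ n : ℕ, c' ≠ -n)
    (hroots : ∀ ρ : ℂ, P.eval ρ = 0 → ρ.re / 2 ≠ c ∧ ρ.re / 2 ≠ c' ∧ |ρ.im| / 2 < T)
    {t : ℝ} (ht : 0 < t) {F : ℂ → ℂ}
    (hF : ∀ w, F w = G (2 * w) / P.eval (2 * w) * (Complex.Gamma w * Complex.Gamma (1 - w)) *
      (t : ℂ) ^ (2 * w - 2)) :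
    ∫ y : ℝ, F (c + y * I) =
      (∫ y : ℝ, F (c' + y * I)) - I * rectBoundaryIntegral F c' c (-T) T := by
  have hcc' : c' < c := by linarith
  have h := integral_vertical_sub_eq_rectBoundaryIntegral hcc' hT
    (differentiableOn_integrand hG (by linarith) hc1 hT hc'N hroots (ofReal_ne_zero.2 ht.ne') hF)
    (integrable_integrand_left_line hc'α hc'h hc'N hroots hb hfe ht hF)
    (integrable_integrand_right_line hG hc hc1 ha hroots ht hF)
    (integrand_decay hG hfin hP ha hb hfe hc hc1 hc'α hc'h hc'N hroots ht hF)
  have hI : I * I = -1 := I_mul_I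
  linear_combination (-I) * h + ((∫ y : ℝ, F (c + y * I)) - ∫ y : ℝ, F (c' + y * I)) * hI

/-- **The integral over the left line.** For `t > 0`,
`∫ F_t(c' + iy) dy = (2π²/t) ∑_{n ≥ 1} bₙ e^{−2πnt}`: by `integrand_left_line` the integrand is
`(2π/t) g(−2y)` with `g` the Cahen–Mellin integrand of `∑ bₙ e^{−n(2πt)}` on `re v = 1 − 2c'`, and
`(1/2π)∫ g = ∑ bₙ e^{−2πnt}` (`tsum_mul_exp_neg_eq_integral_LSeries_of_pos`). This is Titchmarsh's
"`= (2/√x) ∑ bₙ e^{−πn²/x}`" step in Mellin–Barnes form. [cite: Titchmarsh1986, §2.13] -/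
theorem integral_left_line_eq (hc'α : 2 * c' < -α) (hc'h : c' ≤ -1 / 2)
    (hc'N : ∀ n : ℕ, c' ≠ -n)
    (hroots : ∀ ρ : ℂ, P.eval ρ = 0 → ρ.re / 2 ≠ c ∧ ρ.re / 2 ≠ c' ∧ |ρ.im| / 2 < T)
    (hb : ∀ s : ℂ, s.re < -α → LSeriesSummable b (1 - s))
    (hfe : ∀ s : ℂ, s.re < -α → P.eval s ≠ 0 → (∀ n : ℕ, s ≠ -(2 * (n : ℂ))) →
      G s / P.eval s * Complex.Gamma (s / 2) * (π : ℂ) ^ (-s / 2) =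
        LSeries b (1 - s) * Complex.Gamma (1 / 2 - s / 2) * (π : ℂ) ^ (-(1 - s) / 2))
    {t : ℝ} (ht : 0 < t) {F : ℂ → ℂ}
    (hF : ∀ w, F w = G (2 * w) / P.eval (2 * w) * (Complex.Gamma w * Complex.Gamma (1 - w)) *
      (t : ℂ) ^ (2 * w - 2)) :
    ∫ y : ℝ, F (c' + y * I) =
      (2 * π ^ 2 / t : ℂ) * ∑' n : ℕ, (if n = 0 then 0 else b n * (Real.exp (-(n * (2 * π * t))) : ℂ)) := by
  have hC0 : 0 < 1 - 2 * c' := by linarith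
  have hbC : LSeriesSummable b ((1 - 2 * c' : ℝ) : ℂ) := by
    have h := hb (2 * c') (by simp; linarith)
    convert h using 1; push_cast; ring
  have hW : 0 < 2 * π * t := by positivity
  have hπ0 : (π : ℂ) ≠ 0 := ofReal_ne_zero.2 Real.pi_ne_zero
  have ht0 : (t : ℂ) ≠ 0 := ofReal_ne_zero.2 ht.ne'
  set g : ℝ → ℂ := fun y' ↦ LSeries b (((1 - 2 * c' : ℝ) : ℂ) + y' * I) *
    ((((2 * π * t : ℝ)) : ℂ) ^ (-(((1 - 2 * c' : ℝ) : ℂ) + y' * I)) *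
      Complex.Gamma (((1 - 2 * c' : ℝ) : ℂ) + y' * I)) with hg
  have hFg : ∀ y : ℝ, F (c' + y * I) = (2 * π / t : ℂ) * g ((-2) * y) := fun y ↦ by
    rw [integrand_left_line hc'α hc'N hroots hfe ht hF y]
  have hB3 := tsum_mul_exp_neg_eq_integral_LSeries_of_pos b hC0 hbC hW
  calc ∫ y : ℝ, F (c' + y * I) = ∫ y : ℝ, (2 * π / t : ℂ) * g ((-2) * y) :=
        integral_congr_ae (Eventually.of_forall hFg)
    _ = (2 * π / t : ℂ) * ∫ y : ℝ, g ((-2) * y) := integral_const_mul _ _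
    _ = (2 * π / t : ℂ) * ((|(-2 : ℝ)⁻¹|) • ∫ y : ℝ, g y) := by
        rw [Measure.integral_comp_mul_left g (-2)]
    _ = (π / t : ℂ) * ∫ y : ℝ, g y := by
        rw [show |(-2 : ℝ)⁻¹| = 1 / 2 by norm_num, Complex.real_smul]
        push_cast
        ring
    _ = (2 * π ^ 2 / t : ℂ) * ((1 / (2 * π) : ℂ) * ∫ y : ℝ, g y) := by
        field_simp
    _ = _ := by rw [hB3]

end shift

end Hamburger1921

end Literature.Barriers.RiemannHypothesis
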